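import Mathlib
import Summits.Ventures.PercRepro2.Tail2DBlockCalc
import Summits.Ventures.PercRepro2.Tail2DHarrisSP
import Summits.Ventures.PercRepro2.Tail2DFlowOneBlocks
import Summits.Ventures.PercRepro2.Tail2DFlowOneStep01
import Summits.Ventures.PercRepro2.Tail2DParFin
import Summits.Ventures.PercRepro2.Tail2DParFinFlip
import Summits.Ventures.PercRepro2.Tail2DParFinTop
import Summits.Ventures.PercRepro2.Tail2DParFinDiag
import Summits.Ventures.PercRepro2.Tail2DParFinCount
import Summits.Ventures.PercRepro2.Tail2DParFinRelax
import Summits.Ventures.PercRepro2.Tail2DParFinSubTop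
import Summits.Ventures.PercRepro2.Tail2DParFinSubTopB
import Summits.Ventures.PercRepro2.Tail2DParFinFibres
import Summits.Ventures.PercRepro2.Tail2DOneChange
import Summits.Ventures.PercRepro2.Tail2DOneChangeB
import Summits.Ventures.PercRepro2.Tail2DOneChangeC
import Summits.Ventures.PercRepro2.Tail2DSDomSwap
import Summits.Ventures.PercRepro2.Tail2DBlockCertP2P2
import Summits.Ventures.PercRepro2.Tail2DFlowOneAxis
import Summits.Ventures.PercRepro2.Tail2DAxisClass
import Summits.Ventures.PercRepro2.Tail2DParFinSubTopC
import Summits.Ventures.PercRepro2.Tail2DParFinSubTopD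

/-!
# (SD) at `(2, 0)` on `Y ∥ Y ∥ Y ∥ Y` for any flow-one `Y` — the first position below the sub-top level
(seat mine-b, cell pub-perc-repro2; conjectures/MINE-B.md §44)

Four IDENTICAL flow-one factors with `a = #R_Y = #B_Y`, `c = #C_Y`: `|E(2,0)| = a²(11a² + 16ac + 6c²)`,
`|E(1,1)| = a²·D`, `D = 14a² + 24ac + 12c²`, `λ = (11a² + 16ac + 6c²)/D`.  The one-change certificate (rates by the
type `(#R, #B)` of the word): the bottom words (`#B = 0`) flip a uniformly random red; `RRRB`: stay
`(15a² + 20ac + 6c²)/(2D)`, flip `(5a² + 8ac + 6c²)/(6D)`, relax `(4a² + 6ac)/(3D)` per red; `RRBB`: stay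
`(20a² + 28ac + 12c²)/(3D)`, flip `(5a² + 10ac + 6c²)/(3D)`, relax `(2a² + 2ac)/D`; `RRBC`: stay
`(5a² + 6ac + 2c²)/D`, flip `(5a² + 10ac + 6c²)/(2D)`, relax `(2a² + 2ac)/D` — every rate a ratio of polynomials with
positive coefficients.  With the generic theorem `sdomZ_of_oneChange` the proof is the two per-word identities.
With g41 (top level, diagonal, axes) and the sub-top level, (SD) holds at EVERY position on `Y ∥ Y ∥ Y ∥ Y`.
-/

namespace Summit.Ventures.PercRepro2.Tail2D

open V2Closure Finset

section Four

variable (Y : V2Closure.SP)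

/-- `a = #R_Y` -/
noncomputable def aY : ℚ := ((rSet Y).card : ℚ)
/-- `c = #C_Y` -/
noncomputable def cY : ℚ := ((cellSet Y).card : ℚ)
/-- `D = 14a² + 24ac + 12c²` -/
noncomputable def dY : ℚ := 14 * aY Y ^ 2 + 24 * aY Y * cY Y + 12 * cY Y ^ 2

/-- the identity rate by the type `(#R, #B)` of the word -/
noncomputable def ιT (r b : ℕ) : ℚ :=
  if r = 3 ∧ b = 1 then (15 * aY Y ^ 2 + 20 * aY Y * cY Y + 6 * cY Y ^ 2) / (2 * dY Y)
  else if r = 2 ∧ b = 2 then (20 * aY Y ^ 2 + 28 * aY Y * cY Y + 12 * cY Y ^ 2) / (3 * dY Y)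
  else if r = 2 ∧ b = 1 then (5 * aY Y ^ 2 + 6 * aY Y * cY Y + 2 * cY Y ^ 2) / dY Y
  else 0

/-- the flip rate per red by the type `(#R, #B)` of the word -/
noncomputable def fT (r b : ℕ) : ℚ :=
  if b = 0 then ((r : ℚ))⁻¹
  else if r = 3 ∧ b = 1 then (5 * aY Y ^ 2 + 8 * aY Y * cY Y + 6 * cY Y ^ 2) / (6 * dY Y)
  else if r = 2 ∧ b = 2 then (5 * aY Y ^ 2 + 10 * aY Y * cY Y + 6 * cY Y ^ 2) / (3 * dY Y)
  else if r = 2 ∧ b = 1 then (5 * aY Y ^ 2 + 10 * aY Y * cY Y + 6 * cY Y ^ 2) / (2 * dY Y)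
  else 0

/-- the relax rate per red by the type `(#R, #B)` of the word -/
noncomputable def xT (r b : ℕ) : ℚ :=
  if r = 3 ∧ b = 1 then (4 * aY Y ^ 2 + 6 * aY Y * cY Y) / (3 * dY Y)
  else if r = 2 ∧ (b = 2 ∨ b = 1) then (2 * aY Y ^ 2 + 2 * aY Y * cY Y) / dY Y
  else 0

/-- the rate table of the `(2,0)` certificate on four identical factors -/
noncomputable def fourRates : OCRates 4 where
  ι := fun w => ιT Y (nR 4 w) (nB 4 w)
  f := fun w _ => fT Y (nR 4 w) (nB 4 w)
  x := fun w _ => xT Y (nR 4 w) (nB 4 w)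

variable {Y}

/-- `γ_i = c/a` for every factor -/
theorem gam_four (i : Fin 4) : gam 4 (fun _ => Y) i = cY Y / aY Y := rfl

/-- `D > 0` when `Y` has a red crossing -/
theorem dY_pos (hR : 0 < (rSet Y).card) : 0 < dY Y := by
  unfold dY aY cY
  have : (0 : ℚ) < (rSet Y).card := by exact_mod_cast hR
  positivity

/-- the rates are non-negative -/
theorem fourRates_iota_nonneg (hR : 0 < (rSet Y).card) (w : Fin 4 → Ltr) : 0 ≤ (fourRates Y).ι w := by
  have := dY_pos hR
  show 0 ≤ ιT Y (nR 4 w) (nB 4 w)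
  unfold ιT aY cY
  split_ifs <;> positivity

/-- the flip rates are non-negative -/
theorem fourRates_f_nonneg (hR : 0 < (rSet Y).card) (w : Fin 4 → Ltr) (i : Fin 4) : 0 ≤ (fourRates Y).f w i := by
  have := dY_pos hR
  show 0 ≤ fT Y (nR 4 w) (nB 4 w)
  unfold fT aY cY
  split_ifs <;> positivity

/-- the relax rates are non-negative -/
theorem fourRates_x_nonneg (hR : 0 < (rSet Y).card) (w : Fin 4 → Ltr) (i : Fin 4) : 0 ≤ (fourRates Y).x w i := by
  have := dY_pos hR
  show 0 ≤ xT Y (nR 4 w) (nB 4 w)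
  unfold xT aY cY
  split_ifs <;> positivity

/-- `|E(2,0)| = a²(11a² + 16ac + 6c²)` -/
theorem tailCount_four_20 (hY : FlowOne Y) :
    (tailCount (parFin 4 (fun _ => Y)) 2 0 : ℚ) = aY Y ^ 2 * (11 * aY Y ^ 2 + 16 * aY Y * cY Y + 6 * cY Y ^ 2) := by
  rw [tailCount_parFin_ident 4 Y hY 2 0]
  unfold aY cY
  simp only [Finset.sum_range_succ, Finset.sum_range_zero]
  norm_num [Nat.choose]
  ring

/-- `|E(1,1)| = a²·D` -/
theorem tailCount_four_11 (hY : FlowOne Y) :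
    (tailCount (parFin 4 (fun _ => Y)) 1 1 : ℚ) = aY Y ^ 2 * dY Y := by
  rw [tailCount_parFin_ident 4 Y hY 1 1]
  unfold dY aY cY
  simp only [Finset.sum_range_succ, Finset.sum_range_zero]
  norm_num [Nat.choose]
  ring


/-- the rates of the table by the type of the word -/
theorem fourRates_ι (w : Fin 4 → Ltr) : (fourRates Y).ι w = ιT Y (nR 4 w) (nB 4 w) := rfl
/-- the flip rate by the type of the word -/
theorem fourRates_f (w : Fin 4 → Ltr) (i : Fin 4) : (fourRates Y).f w i = fT Y (nR 4 w) (nB 4 w) := rfl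
/-- the relax rate by the type of the word -/
theorem fourRates_x (w : Fin 4 → Ltr) (i : Fin 4) : (fourRates Y).x w i = xT Y (nR 4 w) (nB 4 w) := rfl

/-- **the source identity** of the `(2,0)` table on four identical factors -/
theorem fourRates_srcOK (hR : 0 < (rSet Y).card) : (fourRates Y).SrcOK (fun _ => Y) 2 0 := by
  intro w hw
  have h3 := nR_add_nB_add_nC 4 w
  have ha : (0 : ℚ) < aY Y := by unfold aY; exact_mod_cast hR
  have hc : (0 : ℚ) ≤ cY Y := by unfold cY; positivity
  have hD := dY_pos hR
  have hsum : ∀ (φ : ℚ), ∑ i ∈ redSet 4 w, φ = (nR 4 w : ℚ) * φ := by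
    intro φ; rw [Finset.sum_const, ← nR_eq_card_redSet, nsmul_eq_mul]
  simp only [gam_four, fourRates_ι, fourRates_f, fourRates_x]
  have hcases : (nR 4 w = 4 ∧ nB 4 w = 0) ∨ (nR 4 w = 3 ∧ nB 4 w = 0) ∨ (nR 4 w = 3 ∧ nB 4 w = 1)
      ∨ (nR 4 w = 2 ∧ nB 4 w = 0) ∨ (nR 4 w = 2 ∧ nB 4 w = 1) ∨ (nR 4 w = 2 ∧ nB 4 w = 2) := by
    have := hw.1; omega
  have hcom : ocCom 4 2 0 w ↔ (2 ≤ nR 4 w ∧ 0 ≤ nB 4 w) ∧ 1 ≤ nB 4 w := Iff.rfl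
  rcases hcases with ⟨hr, hb⟩ | ⟨hr, hb⟩ | ⟨hr, hb⟩ | ⟨hr, hb⟩ | ⟨hr, hb⟩ | ⟨hr, hb⟩ <;>
  · simp only [hcom, hr, hb, hsum, ιT, fT, xT]
    norm_num
    try unfold dY
    try field_simp
    try ring

/-- **the target identity** of the `(2,0)` table on four identical factors -/
theorem fourRates_tgtOK (hY : FlowOne Y) (hR : 0 < (rSet Y).card) : (fourRates Y).TgtOK (fun _ => Y) 2 0 := by
  intro w0 ht
  have h3 := nR_add_nB_add_nC 4 w0
  have ha : (0 : ℚ) < aY Y := by unfold aY; exact_mod_cast hR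
  have hc : (0 : ℚ) ≤ cY Y := by unfold cY; positivity
  have hD := dY_pos hR
  rw [tailCount_four_20 hY, tailCount_four_11 hY]
  simp only [fourRates_ι, fourRates_f, fourRates_x]
  -- the sum over the blue positions: the parents have one more red and one fewer blue
  have hsumB : ∑ j ∈ blueSet 4 w0, (fT Y (nR 4 (Function.update w0 j Ltr.R)) (nB 4 (Function.update w0 j Ltr.R))
      + (if ocCom 4 2 0 (Function.update w0 j Ltr.R)
          then xT Y (nR 4 (Function.update w0 j Ltr.R)) (nB 4 (Function.update w0 j Ltr.R)) else 0))
      = (nB 4 w0 : ℚ) * (fT Y (nR 4 w0 + 1) (nB 4 w0 - 1)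
          + (if (2 ≤ nR 4 w0 + 1 ∧ 0 ≤ nB 4 w0 - 1) ∧ 1 ≤ nB 4 w0 - 1 then xT Y (nR 4 w0 + 1) (nB 4 w0 - 1) else 0)) := by
    rw [nB_eq_card_blueSet, ← nsmul_eq_mul, ← Finset.sum_const]
    apply Finset.sum_congr rfl
    intro j hj
    have hjB : w0 j = Ltr.B := by simpa [blueSet] using hj
    have e1 := nR_update_R 4 w0 j (by rw [hjB]; exact Ltr.noConfusion)
    have e2 := nB_update_R_of_B 4 w0 j hjB
    have e2' : nB 4 (Function.update w0 j Ltr.R) = nB 4 w0 - 1 := by omega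
    have hcom : ocCom 4 2 0 (Function.update w0 j Ltr.R)
        ↔ (2 ≤ nR 4 (Function.update w0 j Ltr.R) ∧ 0 ≤ nB 4 (Function.update w0 j Ltr.R))
          ∧ 1 ≤ nB 4 (Function.update w0 j Ltr.R) := Iff.rfl
    simp only [hcom, e1, e2']
    rw [nB_eq_card_blueSet]
  -- the sum over the `C` positions: the parents have one more red and the same blues
  have hsumC : ∑ l ∈ cSet 4 w0, xT Y (nR 4 (Function.update w0 l Ltr.R)) (nB 4 (Function.update w0 l Ltr.R))
      = (nC 4 w0 : ℚ) * xT Y (nR 4 w0 + 1) (nB 4 w0) := by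
    show _ = ((cSet 4 w0).card : ℚ) * _
    rw [← nsmul_eq_mul, ← Finset.sum_const]
    apply Finset.sum_congr rfl
    intro l hl
    have hlC : w0 l = Ltr.C := by simpa [cSet] using hl
    have e1 := nR_update_R 4 w0 l (by rw [hlC]; exact Ltr.noConfusion)
    have e2 := nB_update_R_of_ne 4 w0 l (by rw [hlC]; exact Ltr.noConfusion)
    rw [e1, e2]
  rw [hsumB, hsumC]
  have hcases : (nR 4 w0 = 1 ∧ nB 4 w0 = 1) ∨ (nR 4 w0 = 1 ∧ nB 4 w0 = 2) ∨ (nR 4 w0 = 1 ∧ nB 4 w0 = 3)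
      ∨ (nR 4 w0 = 2 ∧ nB 4 w0 = 1) ∨ (nR 4 w0 = 2 ∧ nB 4 w0 = 2) ∨ (nR 4 w0 = 3 ∧ nB 4 w0 = 1) := by
    have := ht.1; have := ht.2; omega
  have hcom : ocCom 4 2 0 w0 ↔ (2 ≤ nR 4 w0 ∧ 0 ≤ nB 4 w0) ∧ 1 ≤ nB 4 w0 := Iff.rfl
  rcases hcases with ⟨hr, hb⟩ | ⟨hr, hb⟩ | ⟨hr, hb⟩ | ⟨hr, hb⟩ | ⟨hr, hb⟩ | ⟨hr, hb⟩ <;>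
  · have hnC : nC 4 w0 = 4 - nR 4 w0 - nB 4 w0 := by omega
    simp only [hcom, hr, hb, hnC, ιT, fT, xT]
    norm_num
    try unfold dY
    try field_simp
    try ring

/-- **(SD) at `(2,0)` on `Y ∥ Y ∥ Y ∥ Y`** for any flow-one `Y` with a red crossing -/
theorem sdomZ_four_20 (hY : FlowOne Y) (hR : 0 < (rSet Y).card) : SDomZ (parFin 4 (fun _ => Y)) 2 0 :=
  sdomZ_of_oneChange (fun _ => hY) (fun _ => hR) (by norm_num) (fourRates Y) (fourRates_iota_nonneg hR)
    (fourRates_f_nonneg hR) (fourRates_x_nonneg hR) (fourRates_srcOK hR) (fourRates_tgtOK hY hR)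

/-- **(SD) at `(1,1)` on `Y ∥ Y ∥ Y ∥ Y`**, by the colour swap -/
theorem sdomZ_four_11 (hY : FlowOne Y) (hR : 0 < (rSet Y).card) : SDomZ (parFin 4 (fun _ => Y)) 1 1 := by
  have h := sdomZ_four_20 hY hR
  rw [sdomZ_swap_iff] at h
  norm_num at h
  exact h


/-- a comb of flow-one factors with red crossings is in the axis class -/
theorem axisComb_parFin : ∀ (k : ℕ) (X : Fin k → V2Closure.SP), (∀ i, FlowOneR (X i)) → AxisComb (parFin k X)
  | 0, _, _ => AxisComb.absent
  | k + 1, X, hX => AxisComb.parL (hX 0) (axisComb_parFin k (Fin.tail X) (fun i => hX i.succ))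

/-- the tails of `k` flow-one factors are empty beyond total flow `k` -/
theorem tailCount_parFin_eq_zero (k : ℕ) (X : Fin k → V2Closure.SP) (hX : ∀ i, FlowOne (X i)) (u v : ℕ)
    (h : k < u + v) : tailCount (parFin k X) u v = 0 := by
  rw [tailCount_parFin_eq_sum k X hX]
  apply Finset.sum_eq_zero
  intro w hw
  simp only [Finset.mem_filter, Finset.mem_univ, true_and] at hw
  have := nR_add_nB_le k w
  omega

/-- **(SD) at EVERY clipped position on `Y ∥ Y ∥ Y ∥ Y`** for any flow-one `Y` with a red crossing: the axes by the
axis class, the empty tails, Harris at `u ≤ 1, v ≤ 0`, and the ten positions with `1 ≤ u`, `0 ≤ v`, `u + v ≤ 4` —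
the top level, the sub-top level, the diagonal and the new `(2,0)` / `(1,1)` -/
theorem sdomZ_four_all (hY : FlowOne Y) (hR : 0 < (rSet Y).card) (u v : ℤ) : SDomZ (parFin 4 (fun _ => Y)) u v := by
  have hX : ∀ i : Fin 4, FlowOne ((fun _ => Y) i) := fun _ => hY
  have hR' : ∀ i : Fin 4, 0 < (rSet ((fun _ => Y) i)).card := fun _ => hR
  by_cases haxis : u ≤ 0 ∨ v ≤ -1
  · exact sdomZ_axisComb_axis (axisComb_parFin 4 (fun _ => Y) (fun _ => ⟨hY, hR⟩)) u v haxis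
  push Not at haxis
  obtain ⟨u', rfl⟩ : ∃ u' : ℕ, u = u' := ⟨u.toNat, by omega⟩
  obtain ⟨v', rfl⟩ : ∃ v' : ℕ, v = v' := ⟨v.toNat, by omega⟩
  have hu : 1 ≤ u' := by omega
  by_cases hbig : 4 < u' + v'
  · apply sdomZ_of_tailCount_zero
    left
    rw [show ((u' : ℤ)).toNat = u' by omega, show ((v' : ℤ)).toNat = v' by omega]
    exact tailCount_parFin_eq_zero 4 _ hX u' v' hbig
  push Not at hbig
  rcases (show u' + v' = 4 ∨ u' + v' = 3 ∨ u' = v' + 1 ∨ (u' = 2 ∧ v' = 0) ∨ (u' = 1 ∧ v' = 1) ∨ (u' = 1 ∧ v' = 0)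
      by omega) with h | h | h | ⟨h1, h2⟩ | ⟨h1, h2⟩ | ⟨h1, h2⟩
  · -- the top level
    have := sdomZ_parFin_top 4 (fun _ => Y) u' hX hu (by omega)
    rwa [show 4 - u' = v' by omega] at this
  · -- the sub-top level
    exact sdomZ_parFin_subtop_all 4 (fun _ => Y) u' v' hX hR' (by omega) hu
  · -- the diagonal
    subst h
    have := sdomZ_parFin_diag 4 (fun _ => Y) (v' + 1) hX (by omega)
    push_cast at this
    simpa using this
  · subst h1; subst h2; exact sdomZ_four_20 hY hR
  · subst h1; subst h2; exact sdomZ_four_11 hY hR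
  · subst h1; subst h2; exact sdomZ_of_le_one _ _ _ (by norm_num) (by norm_num)

end Four

end Summit.Ventures.PercRepro2.Tail2D
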